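import Summits.QuantumFields.YangMills.Theorems.UnitScaleTiltHalvingCombTorusTower
import Summits.QuantumFields.YangMills.Theorems.UnitScaleTiltHalvingCombStepGeometry
import Summits.QuantumFields.YangMills.Theorems.UnitScaleTiltProp8ChartDoubleBarOneStep
import HarnessLib

/-!
# Line H (`BirthV10.stub_halvingStep`, stmt-QuantumFields-19200) — (M2′) (b)-row toolbox, the FIELD-SIDE ROW (F-h) of brick (B-al-4)₃:
# ★★ THE CENTRE STAIRS OF THE TORUS DOUBLE-BAR TOWER ARE SMALL, GEOMETRICALLY IN THE LEVEL, FROM THE COMB∕DOUBLE-BAR DEFECT ROW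
# ([Balaban1985Averaging] pp.24–25, (89), (110); [Balaban1987RG1] (0.1)–(0.4))

Cell `ym3-torus` (HUMAN RULING D-0037: YM₃ on T³ is ladder rung R3 — NOT d = 4, NOT infinite volume, NOT a mass gap, NOT the Clay problem), width seat `ym-ust-19200-w3`
gen 11 (B-al lineage; CLAIM 2026-08-29T04:41:48Z; consumer ym-ust-20520-w3 g9 LOCATE `LOCATE-BAL4-3-ROWS-w3g9.md` §2 and ■ FINAL 04:49:24Z «YES — … your GLOBAL-in-`y`
(F-h) … impl[ies the skeleton's `hStair`] by restriction»).  `--supports stmt-QuantumFields-19200 --as helper`; THEOREMS ONLY (0 `def`, 0 `sorry`); count-neutral; nothing here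
claims B-al-2, (B-al-4)₃, the (b)-row, (M2′), the stub, the crux or the gap.

WHY.  The (b)-row door ✓`HalvingHStokesRowOfCombDefect.hStokes_of_rows` displays a row `hG` ((B-al-4): the effective gauge of the datum down the double-bar tower of the
pre-gauged member field `X̂ = (U^{gJ})♭` stays near `1`).  Its supplier-to-be `hG_of_rows` runs the k-level induction ✓`HalvingEffGaugeTowerRatio.norm_effGauge_ratio_le_of_pyramid`,
whose row `hH` asks that the CENTRE-STAIR transporters `U̿^{(j)}X̂(Γ^σ_{y → y+n})` be within `hh j` of `1` with `hh j` GEOMETRIC in `j` (the recursion's source `hh j·e j` must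
be top-dominated for k-uniformity; the crude `8ℓ·Lᵏ·s₀` of ✓`P1FlatCoreFrameLinStar.norm_holT_stair_dbarIterU_sub_one_le` is not in that currency).  The geometric currency
comes from the COMB side: B-al-2's per-level invariant `H_j` («`‖D_j(π_j b)⁻¹·C_j(b) − 1‖ ≤ r_j`», `D_j = U̿^{(j)}X̂`, `C_j = avgIter L U′ j`, ✓`HalvingCombTorusTower`) and the
block-axiality of `C_j` (J3 (b)) with its ε₀-small plaquettes `p_j = 4ε₀(Lʲ)²(Lᵏ)⁻²`.

WHAT IS PROVED (namespace `…Theorems.HalvingDbarStairSizes`).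
* §1 (`ℤᵈ`, any normed ring with `‖1‖ = 1`): ★ `norm_bond_sub_one_le_of_blockAxial` — a `U1`-valued field block-axial on `B(q)` (`C(Γ_{q,q+r}) = 1`) with plaquettes `≤ p` on
  the block has EVERY in-block bond within `d(L−1)·p` of `1` (the field is its own `q`-rooted axial gauge on the block, so lit ✓`axial_bond_bound_sharp` applies bare).
* §2 (torus geometry): `coverAt_ne_coverAt_add_e`, ★ `lift_block_bond` — every level-`j` bond with both ends in the block of `π_{j+1} w` is `(π_j x, μ)` with `x, x + e_μ ∈ B(Lw)`
  (★w3 g10's ✓`lift_twoBlock_bond` refined to one block), `exists_coverAt_eq`.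
* §3 (torus, generic): ★ `norm_inBlock_bond_sub_one_le` — in-block bonds of `D` within `d(L−1)p + (102∕100)ρ` of `1` from the defect row `‖D(π_j x,μ)⁻¹C(x,μ) − 1‖ ≤ ρ`
  (✓`norm_sub_le_of_inv_mul`); ★★ `norm_holT_stair_dbar_sub_one_le`∕`_global` — centre stairs within `4ℓ·(d(L−1)p + (102∕100)ρ)`, `ℓ = (d+2)L` (✓`norm_holT_stair_sub_one_le`).
* §4 (member level, `M₂(ℂ)`): ★★★ `stairSizes_of_levelDefect` — from the socket guards `InAk … univ U′` + block-axiality below the top, the Prop.-2 windows, three scalar windows and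
  the DISPLAYED per-level defect row `hdef` (any `r` with `r j ≤ r⋆` for `j ≤ k`): `∀ j < K−n, ∀ y i, ‖U̿^{(j)}X̂(Γ_i(y)) − 1‖ ≤ hh j := 4ℓ·(d(L−1)·4ε₀(Lʲ)²(Lᵏ)⁻² + (102∕100)·r j)`
  — GEOMETRIC and k-UNIFORM when `r` is (✓`avgIter_mem_U1`, ✓`plaqSmall_avgIter_level`); ★★★ `stairSizes_of_levelDefect_inAx` — the same in the door's `InAx`-family guard letter
  (✓`hblk_of_inAx`).  The row `hdef` is ✓`HalvingCombTorusTower`'s induction invariant; px3 g5's per-level export `comb_eq_dbar_mul_defect_levels_of_step` (04:44:49Z) pins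
  `r j := 240c₁δc²ε₀²·(Lʲ)⁴(Lᵏ)⁻⁴` modulo the step (B-iv).
HONEST SCOPE.  Lattice-gauge bookkeeping over landed bricks; no new analytic estimate.  The unitary twin (F-hU) and the pinned-`r` knit are sibling files.  Nothing of Prop. 3∕4,
Theorem 4, (M2′) or the stub is proved here.

References: T. Bałaban, CMP **98** (1985) 17–51 [Balaban1985Averaging] ((2) p.17, (11) p.19, pp.24–25, Prop. 2 (54) p.26, (89) p.31, (110) p.34, (122)–(123) p.36,
Prop. 4 (134)–(135) pp.38–39); CMP **109** (1987) 249–301 [Balaban1987RG1] ((0.1)–(0.4) pp.251–253); CMP **99** (1985) 75–102 [Balaban1985RegularSpaces] ((1.7) p.77,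
(1.15) p.78, (1.19) p.79, (1.34) p.82).
-/

set_option autoImplicit false

noncomputable section

open scoped BigOperators Matrix.Norms.L2Operator
open NormedSpace

namespace Summit.QuantumFields.YangMills.Theorems.HalvingDbarStairSizes

open Literature.MathematicalPhysics.QuantumFieldTheory.Balaban1983to89
open Literature.MathematicalPhysics.QuantumLattice (blockMap)
open T4Continuum BlockAveraging
open B14DomainGeom (Pt)
open Node00 (coverAt coverAt_apply val_coverAt coverAt_eq_coverAt_iff blockOf_coverAt coverAt_add_e)
open B7Prop1Explicit (e e_apply boxVec axialFn gaugeAct l1 U1 mem_U1 axialFn_mem gaugeAct_mem)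
open B7Prop1Local (InBox bondHi)
open B8Lemma1NonAbelian (lowPart PlaqSmall axial_bond_bound_sharp)
open B10Eq27TorusAxialLog (holT)
open Summit.QuantumFields.YangMills.Theorems.P1FlatCorePreGauge (l1_lowPart_sub_le)
open Summit.QuantumFields.YangMills.Theorems.Prop8ChartDoubleBar (dbarIterU norm_holT_stair_sub_one_le)
open HalvingCombStepGeometry (coverAt_sec sec_coverAt sec_window blockMap_window lift_twoBlock_bond norm_sub_le_of_inv_mul blockMap_smul_add_boxVec)
open HalvingCombPairGauge (exists_boxVec_of_inBox_bondHi)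

/-! ## §1 `ℤᵈ`: every in-block bond of a block-axial field with small plaquettes is near `1` -/

section Zd

variable {d : ℕ} {𝔸 : Type*} [NormedRing 𝔸] [NormOneClass 𝔸]

/-- A block point `q + r`, `r ∈ [0, L)ᵈ`, lies in the order box `[q, q + (L−1)𝟙]`. [cite: Balaban1985Averaging, (2) p.17] (bookkeeping) -/
theorem le_and_le_of_boxVec {L : ℕ} (q : B7Prop1Explicit.Site d) (r : Fin d → Fin L) :
    q ≤ q + boxVec L r ∧ q + boxVec L r ≤ fun i => q i + ((L : ℤ) - 1) := by
  refine ⟨fun i => ?_, fun i => ?_⟩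
  · simp only [Pi.add_apply, boxVec, le_add_iff_nonneg_right]; positivity
  · have := (r i).isLt
    simp only [Pi.add_apply, boxVec]
    omega

/-- `|(L−1)𝟙|₁ = d·(L−1)`. [folklore] -/
theorem l1_blockTop_sub {L : ℕ} (hL : 1 ≤ L) (q : B7Prop1Explicit.Site d) : l1 ((fun i => q i + ((L : ℤ) - 1)) - q) = d * (L - 1) := by
  unfold l1
  have hterm : ∀ i : Fin d, (((fun i => q i + ((L : ℤ) - 1)) - q) i).natAbs = L - 1 := fun i => by
    simp only [Pi.sub_apply]; omega
  simp_rw [hterm]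
  rw [Finset.sum_const, Finset.card_univ, Fintype.card_fin, smul_eq_mul]

/-- ★ **EVERY IN-BLOCK BOND OF A BLOCK-AXIAL FIELD WITH SMALL PLAQUETTES IS NEAR `1`.**  `C` `U1`-valued, block-axial on `B(q)` (`C(Γ_{q,q+r}) = 1` for every `r ∈ [0,L)ᵈ`,
J3 (b)'s letter), plaquettes within `p` on the block `[q, q + (L−1)𝟙]`: for a bond with both ends in the block, `‖C(x, x+e_μ) − 1‖ ≤ d(L−1)·p` — the field IS its own
`q`-rooted axial gauge on the block, so lit ✓`axial_bond_bound_sharp` applies with no gauge factor. [cite: Balaban1985Averaging, pp.24-25] -/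
theorem norm_bond_sub_one_le_of_blockAxial {L : ℕ} (hL : 1 ≤ L) (C : B7Prop1Explicit.Site d → Fin d → 𝔸ˣ) (hCU : ∀ x μ, C x μ ∈ U1 𝔸)
    (q : B7Prop1Explicit.Site d) {p : ℝ} (hp : 0 ≤ p) (hP : PlaqSmall C q (fun i => q i + ((L : ℤ) - 1)) p)
    (hblk : ∀ r : Fin d → Fin L, axialFn C q (q + boxVec L r) = 1)
    (r r' : Fin d → Fin L) (μ : Fin d) (hμ : q + boxVec L r + e μ = q + boxVec L r') :
    ‖((C (q + boxVec L r) μ : 𝔸ˣ) : 𝔸) - 1‖ ≤ ((d * (L - 1) : ℕ) : ℝ) * p := by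
  set x : B7Prop1Explicit.Site d := q + boxVec L r with hx
  have hlo : q ≤ x := (le_and_le_of_boxVec q r).1
  have hhi : x + e μ ≤ fun i => q i + ((L : ℤ) - 1) := by rw [hμ]; exact (le_and_le_of_boxVec q r').2
  have hb := axial_bond_bound_sharp C hCU hP q x μ le_rfl hlo hhi
  have hgauge : gaugeAct (axialFn C q) C x μ = C x μ := by
    show axialFn C q x * C x μ * (axialFn C q (x + e μ))⁻¹ = C x μ
    rw [hblk r, hμ, hblk r', inv_one, one_mul, mul_one]
  rw [hgauge] at hb
  refine hb.trans (mul_le_mul_of_nonneg_right ?_ hp)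
  have h := l1_lowPart_sub_le μ hlo hhi
  rw [l1_blockTop_sub hL] at h
  exact_mod_cast h

end Zd

/-! ## §2 The torus: lift of an in-block bond to the `ℤᵈ` block -/

section Geometry

variable {P : Params} {j : ℕ}

/-- Two coarse sites one coordinate step apart are distinct (`N_{j+1} ≥ 2`). [cite: Balaban1987RG1, (0.1) p.251] (bookkeeping) -/
theorem coverAt_ne_coverAt_add_e (w : Pt P.d) (κ : Fin P.d) : coverAt P (j + 1) w ≠ coverAt P (j + 1) (w + e κ) := by
  intro h
  rw [coverAt_eq_coverAt_iff] at h
  have h1 := h κ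
  simp only [Pi.add_apply, e_apply, if_true, add_sub_cancel_left] at h1
  have hL : 0 < P.L := P.L_pos
  have hN2 : 2 ≤ P.sitesPerDir (j + 1) := by
    unfold Params.sitesPerDir; have : 1 ≤ P.L ^ (P.m + P.K - (j + 1)) := Nat.one_le_pow _ _ hL; omega
  have hle : ((P.sitesPerDir (j + 1) : ℕ) : ℤ) ≤ 1 := Int.le_of_dvd one_pos h1
  omega

/-- ★ **LIFT OF AN IN-BLOCK TORUS BOND TO THE `ℤᵈ` BLOCK.**  Every level-`j` torus bond `b̂` with both ends in the block of `π_{j+1} w` is `(π_j x, μ)` with `x = Lw + r` and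
`x + e_μ = Lw + r′`, `r, r′ ∈ [0, L)ᵈ` (two levels of room, `j + 2 ≤ m + K`; ★w3 g10's ✓`lift_twoBlock_bond` refined to one block: a point of the corner box whose block is
the FIRST block is a first-block point). [cite: Balaban1987RG1, (0.1)-(0.3) pp.251-252] -/
theorem lift_block_bond (hj2 : j + 2 ≤ P.m + P.K) (w : Pt P.d) (b : PBond P j)
    (hsrc : blockOf b.src = coverAt P (j + 1) w) (htgt : blockOf b.tgt = coverAt P (j + 1) w) :
    ∃ (x : Pt P.d) (r r' : Fin P.d → Fin P.L), coverAt P j x = b.src ∧ coverAt P j (x + e b.dir) = b.tgt ∧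
      x = (P.L : ℤ) • w + boxVec P.L r ∧ x + e b.dir = (P.L : ℤ) • w + boxVec P.L r' := by
  have hj : j + 1 ≤ P.m + P.K := by omega
  have hL : 0 < P.L := P.L_pos
  set κ₀ : Fin P.d := ⟨0, P.hd⟩
  obtain ⟨x, hxs, hxt, hxQ, hxeQ⟩ := lift_twoBlock_bond hj2 w κ₀ b (Or.inl hsrc) (Or.inl htgt)
  -- a corner-box point whose block is `π_{j+1} w` is a point of `B(Lw)`
  have key : ∀ x' : Pt P.d, InBox ((P.L : ℤ) • w) (bondHi P.L ((P.L : ℤ) • w) κ₀) x' → blockOf (coverAt P j x') = coverAt P (j + 1) w →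
      ∃ r : Fin P.d → Fin P.L, x' = (P.L : ℤ) • w + boxVec P.L r := by
    intro x' hx' hb'
    rcases exists_boxVec_of_inBox_bondHi w κ₀ hx' with h | ⟨r, hr⟩
    · exact h
    · exfalso
      rw [hr, blockOf_coverAt hj, blockMap_smul_add_boxVec hL] at hb'
      exact coverAt_ne_coverAt_add_e w κ₀ hb'.symm
  obtain ⟨r, hr⟩ := key x hxQ (by rw [hxs]; exact hsrc)
  obtain ⟨r', hr'⟩ := key (x + e b.dir) hxeQ (by rw [hxt]; exact htgt)
  exact ⟨x, r, r', hxs, hxt, hr, hr'⟩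

/-- Every coarse site is a cover image: `y = π_{j+1}(sec₀ y)`. [cite: Balaban1987RG1, (0.1) p.251] (bookkeeping) -/
theorem exists_coverAt_eq (y : Site P (j + 1)) : ∃ w : Pt P.d, coverAt P (j + 1) w = y :=
  ⟨(0 : Pt P.d) + fun μ => ((y μ - coverAt P (j + 1) 0 μ).val : ℤ), coverAt_sec 0 y⟩

end Geometry

/-! ## §3 The torus double bar against the comb field: in-block bonds and centre stairs -/

section Stairs

variable {P : Params} {j : ℕ} {𝔸 : Type*} [NormedRing 𝔸] [NormOneClass 𝔸]

/-- ★ **EVERY IN-BLOCK BOND OF THE TORUS FIELD IS NEAR `1`** when it is bondwise `ρ`-close (through the cover) to a `U1`-valued `ℤᵈ` field that is block-axial with plaquettes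
`≤ p` on the block: `‖D(b̂) − 1‖ ≤ d(L−1)·p + (102∕100)·ρ` for every `b̂` with both ends in the block of `π_{j+1} w` (windows `d(L−1)p, ρ ≤ 1∕200`).
[cite: Balaban1985Averaging, pp.24-25, (11) p.19; Balaban1987RG1, (0.1)-(0.4) pp.251-253] -/
theorem norm_inBlock_bond_sub_one_le (hj2 : j + 2 ≤ P.m + P.K) (C : Pt P.d → Fin P.d → 𝔸ˣ) (hCU : ∀ x μ, C x μ ∈ U1 𝔸) (D : GaugeField P j 𝔸ˣ)
    (w : Pt P.d) {p ρ : ℝ} (hp : 0 ≤ p)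
    (hP : PlaqSmall C ((P.L : ℤ) • w) (fun i => ((P.L : ℤ) • w) i + ((P.L : ℤ) - 1)) p)
    (hblk : ∀ r : Fin P.d → Fin P.L, axialFn C ((P.L : ℤ) • w) ((P.L : ℤ) • w + boxVec P.L r) = 1)
    (hH : ∀ (x : Pt P.d) (μ : Fin P.d), ‖(((D ⟨coverAt P j x, μ⟩)⁻¹ * C x μ : 𝔸ˣ) : 𝔸) - 1‖ ≤ ρ)
    (hδw : ((P.d * (P.L - 1) : ℕ) : ℝ) * p ≤ 1 / 200) (hρw : ρ ≤ 1 / 200)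
    (b : PBond P j) (hsrc : blockOf b.src = coverAt P (j + 1) w) (htgt : blockOf b.tgt = coverAt P (j + 1) w) :
    ‖((D b : 𝔸ˣ) : 𝔸) - 1‖ ≤ ((P.d * (P.L - 1) : ℕ) : ℝ) * p + 102 / 100 * ρ := by
  have hL1 : 1 ≤ P.L := by have := P.hL.2; omega
  obtain ⟨x, r, r', hxs, hxt, hxr, hxr'⟩ := lift_block_bond hj2 w b hsrc htgt
  have hC : ‖((C x b.dir : 𝔸ˣ) : 𝔸) - 1‖ ≤ ((P.d * (P.L - 1) : ℕ) : ℝ) * p := by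
    rw [hxr]
    exact norm_bond_sub_one_le_of_blockAxial hL1 C hCU _ hp hP hblk r r' b.dir (by rw [← hxr, hxr'])
  have hHb : ‖(((D b)⁻¹ * C x b.dir : 𝔸ˣ) : 𝔸) - 1‖ ≤ ρ := by have h := hH x b.dir; rw [hxs] at h; exact h
  exact (norm_sub_le_of_inv_mul hHb hC hδw hρw).2

/-- ★★ **THE CENTRE STAIRS OF THE TORUS FIELD ARE SMALL**: under the hypotheses of `norm_inBlock_bond_sub_one_le` and the window `4ℓ·(d(L−1)p + (102∕100)ρ) ≤ 1`
(`ℓ = (d+2)L`), every centre stair of the block of `π_{j+1} w` is within `4ℓ·(d(L−1)p + (102∕100)ρ)` of `1` (✓`norm_holT_stair_sub_one_le`).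
[cite: Balaban1985Averaging, (110) p.34, (122)-(123) p.36; Balaban1987RG1, (0.3) p.252] -/
theorem norm_holT_stair_dbar_sub_one_le (hj2 : j + 2 ≤ P.m + P.K) (C : Pt P.d → Fin P.d → 𝔸ˣ) (hCU : ∀ x μ, C x μ ∈ U1 𝔸) (D : GaugeField P j 𝔸ˣ)
    (w : Pt P.d) {p ρ : ℝ} (hp : 0 ≤ p) (hρ : 0 ≤ ρ)
    (hP : PlaqSmall C ((P.L : ℤ) • w) (fun i => ((P.L : ℤ) • w) i + ((P.L : ℤ) - 1)) p)
    (hblk : ∀ r : Fin P.d → Fin P.L, axialFn C ((P.L : ℤ) • w) ((P.L : ℤ) • w + boxVec P.L r) = 1)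
    (hH : ∀ (x : Pt P.d) (μ : Fin P.d), ‖(((D ⟨coverAt P j x, μ⟩)⁻¹ * C x μ : 𝔸ˣ) : 𝔸) - 1‖ ≤ ρ)
    (hδw : ((P.d * (P.L - 1) : ℕ) : ℝ) * p ≤ 1 / 200) (hρw : ρ ≤ 1 / 200)
    (hℓw : 4 * (((P.d + 2) * P.L : ℕ) : ℝ) * (((P.d * (P.L - 1) : ℕ) : ℝ) * p + 102 / 100 * ρ) ≤ 1) (i : Idx P) :
    ‖((holT D (emb (coverAt P (j + 1) w)) (stairWord i.2.1 (off i.1)) : 𝔸ˣ) : 𝔸) - 1‖ ≤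
      4 * (((P.d + 2) * P.L : ℕ) : ℝ) * (((P.d * (P.L - 1) : ℕ) : ℝ) * p + 102 / 100 * ρ) :=
  (norm_holT_stair_sub_one_le (by omega) (coverAt P (j + 1) w) (by positivity) hℓw
    (fun b hs ht => norm_inBlock_bond_sub_one_le hj2 C hCU D w hp hP hblk hH hδw hρw b hs ht) i).1

/-- ★★ **THE SAME AT EVERY COARSE SITE**, for a field block-axial on every block with plaquettes `≤ p` on every box (the tower's global letters).
[cite: Balaban1985Averaging, (110) p.34, Prop. 4 (134)-(135) pp.38-39; Balaban1987RG1, (0.3) p.252] -/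
theorem norm_holT_stair_dbar_sub_one_le_global (hj2 : j + 2 ≤ P.m + P.K) (C : Pt P.d → Fin P.d → 𝔸ˣ) (hCU : ∀ x μ, C x μ ∈ U1 𝔸) (D : GaugeField P j 𝔸ˣ)
    {p ρ : ℝ} (hp : 0 ≤ p) (hρ : 0 ≤ ρ)
    (hP : ∀ lo hi : Pt P.d, PlaqSmall C lo hi p)
    (hblk : ∀ (w : Pt P.d) (r : Fin P.d → Fin P.L), axialFn C ((P.L : ℤ) • w) ((P.L : ℤ) • w + boxVec P.L r) = 1)
    (hH : ∀ (x : Pt P.d) (μ : Fin P.d), ‖(((D ⟨coverAt P j x, μ⟩)⁻¹ * C x μ : 𝔸ˣ) : 𝔸) - 1‖ ≤ ρ)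
    (hδw : ((P.d * (P.L - 1) : ℕ) : ℝ) * p ≤ 1 / 200) (hρw : ρ ≤ 1 / 200)
    (hℓw : 4 * (((P.d + 2) * P.L : ℕ) : ℝ) * (((P.d * (P.L - 1) : ℕ) : ℝ) * p + 102 / 100 * ρ) ≤ 1)
    (y : Site P (j + 1)) (i : Idx P) :
    ‖((holT D (emb y) (stairWord i.2.1 (off i.1)) : 𝔸ˣ) : 𝔸) - 1‖ ≤ 4 * (((P.d + 2) * P.L : ℕ) : ℝ) * (((P.d * (P.L - 1) : ℕ) : ℝ) * p + 102 / 100 * ρ) := by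
  obtain ⟨w, rfl⟩ := exists_coverAt_eq y
  exact norm_holT_stair_dbar_sub_one_le hj2 C hCU D w hp hρ (hP _ _) (hblk w) hH hδw hρw hℓw i

end Stairs

/-! ## §4 ★★★ The member level: row (F-h) of (B-al-4)₃ from the per-level comb∕double-bar defect row -/

section Member

open Literature.MathematicalPhysics.QuantumFieldTheory.Balaban1983to89.T3ContinuumYM3Torus
open B7Prop1Explicit renaming Site → LSite
open B7Prop2Explicit (avgIter C0 c2')
open B7Prop2SpecialUnitary (specialUnitaryUnits)
open B8Ineq132 (InAk)
open B8Eq119TwistedAxial (InAx)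
open B10Eq27TorusAxialLog (pull unitsField toUField)
open Summit.QuantumFields.YangMills.Theorems.Prop7AxialReprPrint (pull_toUField_mem pdev_pull_lt)
open HalvingCombTorusTower (avgIter_mem_U1 plaqSmall_avgIter_level p_level_le hblk_of_inAx)

variable (F : T3Family) {n K : ℕ}

/-- ★★★ **ROW (F-h) OF (B-al-4)₃ — THE CENTRE STAIRS OF THE TORUS DOUBLE-BAR TOWER OF THE PRE-GAUGED MEMBER FIELD ARE SMALL, GEOMETRICALLY IN THE LEVEL.**
Member `(F, n, K)`, `k = K − n`, fine `SU(2)` field `U`, pre-gauge `gJ`, `X̂ := (U^{gJ})♭ = unitsField (toUField (gJ•U))`, `U′ := pull X̂ 0`, comb tower `C_j = avgIter L U′ j`,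
double-bar tower `D_j = dbarIterU j X̂`.  HYPOTHESES: the socket guards (a) `InAk` on `univ` (ε₀-regularity ⇒ `C_j` is `SU(2) ⊂ U1`-valued with plaquettes
`≤ p_j := 4ε₀(Lʲ)²(Lᵏ)⁻²` on every box, ✓`HalvingCombTorusTower.avgIter_mem_U1`∕`plaqSmall_avgIter_level`) and (b) block-axiality of `C_j` below the top (`hblk`, J3 (b));
the PER-LEVEL DEFECT ROW `hdef` («H_j»: `‖D_j(π_j x, μ)⁻¹·C_j(x, μ) − 1‖ ≤ r j` at every bond, `j ≤ k` — B-al-2's induction invariant, ✓`comb_eq_dbar_mul_defect_of_step`'s `main`,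
for ANY displayed `r`, bounded by `r⋆` on the levels `j ≤ k`); the Prop.-2 windows and the three scalar windows `d(L−1)·4ε₀ ≤ 1∕200`, `r⋆ ≤ 1∕200`, `4ℓ(d(L−1)·4ε₀ + (102∕100)r⋆) ≤ 1`.
CONCLUSION (✓`HalvingEffGaugeTowerRatio.norm_effGauge_ratio_le_of_pyramid`'s row `hH`, GLOBAL in the coarse site): for every `j < k`, coarse site `y` and stair index `i`,
`‖D_j(Γ^{σ}_{emb y → emb y + n}) − 1‖ ≤ hh j := 4ℓ·(d(L−1)·p_j + (102∕100)·r j)`, `ℓ = (d+2)L` — GEOMETRIC and k-UNIFORM when `r` is.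
[cite: Balaban1985Averaging, pp.24-25, Prop. 2 (54) p.26, (89) p.31, (110) p.34, Prop. 4 (134)-(135) pp.38-39; Balaban1987RG1, (0.1)-(0.4) pp.251-253; Balaban1985RegularSpaces, (1.7) p.77, (1.15) p.78] -/
theorem stairSizes_of_levelDefect {ε₀ : ℝ} (hε₀ : 0 < ε₀)
    (hα3 : C0 (F.P K).d * (2 * ε₀) ≤ 1 / 3) (hα2 : 2 * (2 * ε₀) ≤ c2' (F.P K).d (F.P K).L)
    {r : ℕ → ℝ} {rs : ℝ} (hr1 : ∀ j, j ≤ K - n → r j ≤ rs) (hrs : rs ≤ 1 / 200)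
    (hpw : (((F.P K).d * ((F.P K).L - 1) : ℕ) : ℝ) * (4 * ε₀) ≤ 1 / 200)
    (hℓw : 4 * ((((F.P K).d + 2) * (F.P K).L : ℕ) : ℝ) * ((((F.P K).d * ((F.P K).L - 1) : ℕ) : ℝ) * (4 * ε₀) + 102 / 100 * rs) ≤ 1)
    (U : GaugeField (F.P K) 0 (Matrix.specialUnitaryGroup (Fin 2) ℂ)) (gJ : GaugeTransf (F.P K) 0 (Matrix.specialUnitaryGroup (Fin 2) ℂ))
    (hInAk : InAk (F.P K).L (K - n) (((F.L : ℝ)⁻¹) ^ (K - n)) ε₀ (fun _ => (Set.univ : Set (LSite (F.P K).d)))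
      (pull (unitsField (toUField (GaugeField.gaugeAct gJ U))) 0))
    (hblk : ∀ m, m < K - n → ∀ (z : LSite (F.P K).d) (rr : Fin (F.P K).d → Fin (F.P K).L),
      axialFn (avgIter (F.P K).L (pull (unitsField (toUField (GaugeField.gaugeAct gJ U))) 0) (K - n - (m + 1))) (((F.P K).L : ℤ) • z)
        (((F.P K).L : ℤ) • z + boxVec (F.P K).L rr) = 1)
    (hdef : ∀ j, j ≤ K - n → ∀ (x : LSite (F.P K).d) (μ : Fin (F.P K).d),
      ‖((((dbarIterU j (unitsField (toUField (GaugeField.gaugeAct gJ U)))) ⟨coverAt (F.P K) j x, μ⟩)⁻¹ *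
            avgIter (F.P K).L (pull (unitsField (toUField (GaugeField.gaugeAct gJ U))) 0) j x μ : (Matrix (Fin 2) (Fin 2) ℂ)ˣ) :
          Matrix (Fin 2) (Fin 2) ℂ) - 1‖ ≤ r j) :
    ∀ j, j < K - n → ∀ (y : Site (F.P K) (j + 1)) (i : Idx (F.P K)),
      ‖((holT (dbarIterU j (unitsField (toUField (GaugeField.gaugeAct gJ U)))) (emb y) (stairWord i.2.1 (off i.1)) : (Matrix (Fin 2) (Fin 2) ℂ)ˣ) :
          Matrix (Fin 2) (Fin 2) ℂ) - 1‖ ≤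
        4 * ((((F.P K).d + 2) * (F.P K).L : ℕ) : ℝ) *
          ((((F.P K).d * ((F.P K).L - 1) : ℕ) : ℝ) * (4 * ε₀ * (((F.P K).L : ℝ) ^ j) ^ 2 * ((((F.P K).L : ℝ) ^ (K - n))⁻¹) ^ 2) + 102 / 100 * r j) := by
  intro j hj y i
  -- letters
  set X : GaugeField (F.P K) 0 (Matrix (Fin 2) (Fin 2) ℂ)ˣ := unitsField (toUField (GaugeField.gaugeAct gJ U)) with hX
  set U' : LSite (F.P K).d → Fin (F.P K).d → (Matrix (Fin 2) (Fin 2) ℂ)ˣ := pull X 0 with hU'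
  set k : ℕ := K - n with hk
  set Lr : ℝ := ((F.P K).L : ℝ) with hLr
  have hL2 : 2 ≤ (F.P K).L := (F.P K).hL.2
  have hL1 : (1 : ℝ) ≤ Lr := by rw [hLr]; exact_mod_cast (le_trans (by norm_num) hL2)
  have hjk : j ≤ k := hj.le
  have hroom : j + 2 ≤ (F.P K).m + (F.P K).K := by show j + 2 ≤ F.m + K; have := F.hm; omega
  -- the fine data: `U′` is `SU(2)`-valued with (52) at threshold `2ε₀L^{−2k}`
  have hU'G : ∀ w κ, U' w κ ∈ specialUnitaryUnits (Fin 2) := pull_toUField_mem (GaugeField.gaugeAct gJ U) 0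
  have h52 : B7Prop2Explicit.pdev U' < 2 * ε₀ * ((Lr ^ k)⁻¹) ^ 2 := by
    have h := pdev_pull_lt hε₀ hInAk 0
    rw [hLr]; exact h
  -- per-level data at level `j`
  set p : ℝ := 4 * ε₀ * (Lr ^ j) ^ 2 * ((Lr ^ k)⁻¹) ^ 2 with hp
  have hp0 : 0 ≤ p := by positivity
  have hp4 : p ≤ 4 * ε₀ := p_level_le hL1 hε₀.le hjk
  have hCU : ∀ x μ, avgIter (F.P K).L U' j x μ ∈ U1 (Matrix (Fin 2) (Fin 2) ℂ) :=
    fun x μ => avgIter_mem_U1 U' hU'G hε₀ hα3 hα2 (by rw [← hLr]; exact h52) hjk x μ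
  have hCP : ∀ lo hi, PlaqSmall (avgIter (F.P K).L U' j) lo hi p := fun lo hi => by
    have h := plaqSmall_avgIter_level U' hU'G hε₀ hα3 hα2 (k := k) (by rw [← hLr]; exact h52) hjk lo hi
    rw [hp, hLr]; exact h
  have hCax : ∀ (zz : LSite (F.P K).d) (rr : Fin (F.P K).d → Fin (F.P K).L),
      axialFn (avgIter (F.P K).L U' j) (((F.P K).L : ℤ) • zz) (((F.P K).L : ℤ) • zz + boxVec (F.P K).L rr) = 1 := by
    intro zz rr
    have hm : k - 1 - j < K - n := by omega
    have h := hblk (k - 1 - j) hm zz rr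
    have hidx : K - n - (k - 1 - j + 1) = j := by omega
    rw [hidx] at h
    exact h
  -- the three windows at level `j`
  have hdd0 : (0 : ℝ) ≤ (((F.P K).d * ((F.P K).L - 1) : ℕ) : ℝ) := Nat.cast_nonneg _
  have hℓ0 : (0 : ℝ) ≤ 4 * ((((F.P K).d + 2) * (F.P K).L : ℕ) : ℝ) := by positivity
  have hδw : (((F.P K).d * ((F.P K).L - 1) : ℕ) : ℝ) * p ≤ 1 / 200 := (mul_le_mul_of_nonneg_left hp4 hdd0).trans hpw
  have hr0 : 0 ≤ r j := (norm_nonneg _).trans (hdef j hjk 0 ⟨0, (F.P K).hd⟩)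
  have hρw : r j ≤ 1 / 200 := (hr1 j hjk).trans hrs
  have hℓw' : 4 * ((((F.P K).d + 2) * (F.P K).L : ℕ) : ℝ) * ((((F.P K).d * ((F.P K).L - 1) : ℕ) : ℝ) * p + 102 / 100 * r j) ≤ 1 := by
    have hmono : (((F.P K).d * ((F.P K).L - 1) : ℕ) : ℝ) * p + 102 / 100 * r j ≤
        (((F.P K).d * ((F.P K).L - 1) : ℕ) : ℝ) * (4 * ε₀) + 102 / 100 * rs :=
      add_le_add (mul_le_mul_of_nonneg_left hp4 hdd0) (by linarith [hr1 j hjk])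
    exact (mul_le_mul_of_nonneg_left hmono hℓ0).trans hℓw
  -- the stairs
  have h := norm_holT_stair_dbar_sub_one_le_global hroom (avgIter (F.P K).L U' j) hCU (dbarIterU j X) hp0 hr0 hCP hCax (hdef j hjk) hδw hρw hℓw' y i
  rw [hp, hLr] at h
  exact h

/-- ★★★ **THE SAME, IN THE B-al-3 DOOR's TWO GUARD LETTERS** (`InAk … univ U′` and the `InAx` family guard `∀ m′ ≤ K−n, ∀ Λ, InAx L m′ Λ 1 U′`; block-axiality below the top is
DERIVED, ✓`HalvingCombTorusTower.hblk_of_inAx`). [cite: Balaban1985Averaging, Prop. 4 (134)-(135) pp.38-39; Balaban1985RegularSpaces, (1.19) p.79, (1.34) p.82] -/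
theorem stairSizes_of_levelDefect_inAx {ε₀ : ℝ} (hε₀ : 0 < ε₀)
    (hα3 : C0 (F.P K).d * (2 * ε₀) ≤ 1 / 3) (hα2 : 2 * (2 * ε₀) ≤ c2' (F.P K).d (F.P K).L)
    {r : ℕ → ℝ} {rs : ℝ} (hr1 : ∀ j, j ≤ K - n → r j ≤ rs) (hrs : rs ≤ 1 / 200)
    (hpw : (((F.P K).d * ((F.P K).L - 1) : ℕ) : ℝ) * (4 * ε₀) ≤ 1 / 200)
    (hℓw : 4 * ((((F.P K).d + 2) * (F.P K).L : ℕ) : ℝ) * ((((F.P K).d * ((F.P K).L - 1) : ℕ) : ℝ) * (4 * ε₀) + 102 / 100 * rs) ≤ 1)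
    (U : GaugeField (F.P K) 0 (Matrix.specialUnitaryGroup (Fin 2) ℂ)) (gJ : GaugeTransf (F.P K) 0 (Matrix.specialUnitaryGroup (Fin 2) ℂ))
    (hInAk : InAk (F.P K).L (K - n) (((F.L : ℝ)⁻¹) ^ (K - n)) ε₀ (fun _ => (Set.univ : Set (LSite (F.P K).d)))
      (pull (unitsField (toUField (GaugeField.gaugeAct gJ U))) 0))
    (hInAx : ∀ m, m ≤ K - n → ∀ Λ : ℕ → Set (LSite (F.P K).d),
      InAx (F.P K).L m Λ (1 : LSite (F.P K).d → Fin (F.P K).d → (Matrix (Fin 2) (Fin 2) ℂ)ˣ) (pull (unitsField (toUField (GaugeField.gaugeAct gJ U))) 0))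
    (hdef : ∀ j, j ≤ K - n → ∀ (x : LSite (F.P K).d) (μ : Fin (F.P K).d),
      ‖((((dbarIterU j (unitsField (toUField (GaugeField.gaugeAct gJ U)))) ⟨coverAt (F.P K) j x, μ⟩)⁻¹ *
            avgIter (F.P K).L (pull (unitsField (toUField (GaugeField.gaugeAct gJ U))) 0) j x μ : (Matrix (Fin 2) (Fin 2) ℂ)ˣ) :
          Matrix (Fin 2) (Fin 2) ℂ) - 1‖ ≤ r j) :
    ∀ j, j < K - n → ∀ (y : Site (F.P K) (j + 1)) (i : Idx (F.P K)),
      ‖((holT (dbarIterU j (unitsField (toUField (GaugeField.gaugeAct gJ U)))) (emb y) (stairWord i.2.1 (off i.1)) : (Matrix (Fin 2) (Fin 2) ℂ)ˣ) :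
          Matrix (Fin 2) (Fin 2) ℂ) - 1‖ ≤
        4 * ((((F.P K).d + 2) * (F.P K).L : ℕ) : ℝ) *
          ((((F.P K).d * ((F.P K).L - 1) : ℕ) : ℝ) * (4 * ε₀ * (((F.P K).L : ℝ) ^ j) ^ 2 * ((((F.P K).L : ℝ) ^ (K - n))⁻¹) ^ 2) + 102 / 100 * r j) :=
  stairSizes_of_levelDefect F hε₀ hα3 hα2 hr1 hrs hpw hℓw U gJ hInAk (hblk_of_inAx _ hInAx) hdef

end Member


end Summit.QuantumFields.YangMills.Theorems.HalvingDbarStairSizes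

end
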